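import Summits.HodgeConjecture.CorCM.TwoSexticFieldsFrameTransfer
import HarnessLib

/-!
# COR-CM — TWO sextic CM fields sharing `k`: fibre counts, the pair `k`-structure `(i₀ δ, ī₁ δ)` and the Weil
# plane of `B₁ × B₂` modulo Markman

Cell `pub-hodgecm2` (COR-CM), seat b30 gen 16 (2026-08-21); COUNT-NEUTRAL; theorems only apart from one bookkeeping
definition (`pairStructure`, the dependent family `(i₀ δ, ī₁ δ)` over the two threefold slots); no named fact, no `sorry`.
Second file of the series TWO-FIELD-PAIR (first: `CorCM/TwoSexticFieldsFrameTransfer.lean`).  SETTING as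
there: `k = Kf i₀` imaginary quadratic (`[k:ℚ] = 2`, `τ(δ) = i√d`), TWO sextic fields `K_m = Kf (tl m)` (`m = 0, 1`,
`[K_m:ℚ] = 6`) with ring maps `i m : k → K_m`, realisations `A₃ j ⊨ (Kf (slots i₀ tl j); Φ₃ j)` of the three slots
`(i₀, tl 0, tl 1)`, `B_{m+1} = A₃ (m+1)` with `Φ₃ (m+1)` of sign `true` exactly over the place `m` in the frame `e m`
(`hΦ`, `he_sign`).

* §1 `card_fibre_zero₂`, `card_fibre_one₂` — the fibre counts `1` (of `Φ₃ 1` over `τ` via `i 0`) and `2` (of `Φ₃ 2`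
  over `τ` via `ī 1 = i 1 ∘ c_k`); `pairStructure` (the dependent family `(i₀ δ, ī₁ δ) : ∀ j : Fin 2, 𝓞 (K_j)`) and
  `apply_weilFamily_eq₂` — its constant eigenvalue `±i√d` on the points of the pair weights `W_±`
  [cite: Deligne1982HodgeCycles, §5 (c)] [cite: vanGeemen1994HodgeAV, 4.9];
* §2 **`weilClassesOf_biproduct_succ_le_algebraicClasses_of_markman`** — the whole Weil plane of
  `(⨁_{j<2} B_{j+1}, ι₁(i₀δ) ⊕ ι₂(ī₁δ))`, a plane of `(3,3)`-classes on a CM abelian SIXFOLD with TWO DIFFERENT sextic CM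
  fields, is algebraic GIVEN ONLY Markman's fourfold theorem: gen 13's two-field lemma
  `CMThreefoldPair.weilClassesOf_prod_le_algebraicClasses_of_markman_curveFree` (elliptic completions `B₁ × E′`,
  `E′ × B₂`; `K₁ ≠ K₂` allowed there by design) transported from `B₁ × B₂` to the biproduct
  [cite: Markman2025SurveySecant, Thm. 1.2 and §11.5 Step 2].
The generators `pair6` / `weil4` proper are in `CorCM/TwoSexticFieldsGenerators.lean`.

## References
* [Markman2025SurveySecant] E. Markman, arXiv:2509.23403, Thm. 1.2.  [vanGeemen1994HodgeAV] B. van Geemen, LNM 1594,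
  3.6–3.7, 4.9.  [Deligne1982HodgeCycles] LNM 900, §5 (c).  [Milne2020HodgeClassesAV] 1.2 (a).  [Shimura1998] §5.2.
-/

noncomputable section

open CategoryTheory CategoryTheory.Limits NumberField

namespace Summit.HodgeConjecture.CorCM.TwoSexticFields

open Literature.AlgebraicGeometry Literature.AlgebraicGeometry.Motives Literature.AlgebraicGeometry.HodgeTheory
open Literature.AlgebraicGeometry.ComplexMultiplication (IsCMTypeRealisation)
open Literature.AlgebraicGeometry.Pohlmann1968
open Literature.AlgebraicTopology.SingularHomology
open Literature.NumberTheory.ComplexMultiplication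
open Summit.HodgeConjecture.CorCM.Census.DihedralSexticPair (weilPlus weilMinus weil_structure)
open Summit.HodgeConjecture.CorCM.Census.DihedralSexticPairCurve (Pt' weil4 pair6 mem_weil4_iff mem_pair6_iff
  gens_balanced)
open Summit.HodgeConjecture.CorCM.DihedralSexticPair (card_filter_equiv_mem comp_eq_conjugate_of_sign_false
  comp_comp_complexConj eq_or_eq_conjugate)
open Summit.HodgeConjecture.CorCM.DihedralSexticPairCurve (weilClassesOf_biproduct_le_algebraicClasses_of_biprod)
open Summit.HodgeConjecture.CorCM.PairWeights
open Summit.HodgeConjecture.CorCM.CMWeights (weightClassesAlg_map_le_algebraicClasses sigma_map_injective)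

open scoped Classical

/-! ## §1 Fibre counts and eigenvalues with two frames -/

section Counts

variable {I : Type} {Kf : I → Type} [∀ i, Field (Kf i)]
  {i₀ : I} {tl : Fin 2 → I} {e : ∀ m : Fin 2, (Kf (tl m) →+* ℂ) ≃ ZMod 3 × Bool} {τ : Kf i₀ →+* ℂ}
  {i : ∀ m : Fin 2, Kf i₀ →+* Kf (tl m)}
  (he_sign : ∀ (m : Fin 2) (s : Kf (tl m) →+* ℂ), s.comp (i m) = τ ↔ (e m s).2 = true)
  {Φ₃ : ∀ j : Fin 3, CMType (Kf (slots i₀ tl j))}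
  (hΦ : ∀ (m : Fin 2) (s : Kf (tl m) →+* ℂ), s ∈ (Φ₃ m.succ).1 ↔ (e m s).2 = decide ((e m s).1.val = m.val))

include he_sign hΦ in
/-- **Fibre count `1`**: exactly one embedding of `Φ₃ 1` restricts to `τ` along `i 0` (`(B₁, k)` has type `(1,2)`).
[cite: Deligne1982HodgeCycles, §5 (c)] -/
theorem card_fibre_zero₂ [∀ i, NumberField (Kf i)] :
    (Finset.univ.filter fun s : Kf (tl 0) →+* ℂ => s.comp (i 0) = τ ∧ s ∈ (Φ₃ (0 : Fin 2).succ).1).card = 1 := by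
  have hfilter : (Finset.univ.filter fun s : Kf (tl 0) →+* ℂ => s.comp (i 0) = τ ∧ s ∈ (Φ₃ (0 : Fin 2).succ).1) =
      Finset.univ.filter fun s => e 0 s ∈ ({((0 : ZMod 3), true)} : Finset (ZMod 3 × Bool)) := by
    refine Finset.filter_congr fun s _ => ?_
    rw [he_sign 0, hΦ 0 s, Finset.mem_singleton, Prod.ext_iff]
    constructor
    · rintro ⟨h1, h2⟩
      rw [h1] at h2
      refine ⟨?_, h1⟩
      have h3 : (e 0 s).1.val = (0 : Fin 2).val := of_decide_eq_true h2.symm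
      exact Fin.ext h3
    · rintro ⟨h1, h2⟩
      refine ⟨h2, ?_⟩
      rw [h2, h1]
      rfl
  rw [hfilter, card_filter_equiv_mem, Finset.card_singleton]

include he_sign hΦ in
/-- **Fibre count `2`**: exactly two embeddings of `Φ₃ 2` restrict to `τ` along `ī 1 = i 1 ∘ c_k` (`(B₂, k)` has type
`(2,1)` for the conjugate `k`-structure). [cite: Deligne1982HodgeCycles, §5 (c)] -/
theorem card_fibre_one₂ [∀ i, NumberField (Kf i)] [∀ i, IsCMField (Kf i)] (h2 : Module.finrank ℚ (Kf i₀) = 2)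
    {δ : 𝓞 (Kf i₀)} {d : ℕ} (hd : 0 < d) (hτ : τ (δ : Kf i₀) = Complex.I * (Real.sqrt d : ℂ)) :
    (Finset.univ.filter fun s : Kf (tl 1) →+* ℂ =>
      s.comp ((i 1).comp (IsCMField.complexConj (Kf i₀)).toRingEquiv.toRingHom) = τ ∧
        s ∈ (Φ₃ (1 : Fin 2).succ).1).card = 2 := by
  have hfilter : (Finset.univ.filter fun s : Kf (tl 1) →+* ℂ =>
      s.comp ((i 1).comp (IsCMField.complexConj (Kf i₀)).toRingEquiv.toRingHom) = τ ∧ s ∈ (Φ₃ (1 : Fin 2).succ).1) =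
      Finset.univ.filter fun s => e 1 s ∈ ({((0 : ZMod 3), false), ((2 : ZMod 3), false)} : Finset (ZMod 3 × Bool)) := by
    refine Finset.filter_congr fun s _ => ?_
    have hsign : s.comp ((i 1).comp (IsCMField.complexConj (Kf i₀)).toRingEquiv.toRingHom) = τ ↔ (e 1 s).2 = false := by
      rw [comp_comp_complexConj]
      constructor
      · intro h1
        by_contra h3
        rw [Bool.not_eq_false, ← he_sign 1] at h3
        rw [h3] at h1
        exact CMThreefoldPair.conjugate_ne_of_apply_eq hd hτ h1
      · intro h1
        rw [comp_eq_conjugate_of_sign_false (he_sign 1) h2 hd hτ h1]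
        exact ComplexEmbedding.involutive_conjugate (Kf i₀) τ
    rw [hsign, hΦ 1 s]
    have key : ∀ y : ZMod 3 × Bool, (y.2 = false ∧ (y.2 = decide (y.1.val = (1 : Fin 2).val))) ↔
        y ∈ ({((0 : ZMod 3), false), ((2 : ZMod 3), false)} : Finset (ZMod 3 × Bool)) := by decide
    exact key (e 1 s)
  rw [hfilter, card_filter_equiv_mem]
  decide

/-- **The `k`-structure `(i₀ δ, ī₁ δ)` on the two threefold slots** — the dependent family
`(RingOfIntegers.mapRingHom (i 0) δ, RingOfIntegers.mapRingHom (i 1 ∘ c_k) δ) : ∀ j : Fin 2, 𝓞 (K_j)` (bookkeeping;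
`Fin.cases`, so that both components are definitional). [cite: Deligne1982HodgeCycles, §5 (c)] -/
def pairStructure [∀ i, NumberField (Kf i)] [∀ i, IsCMField (Kf i)] (i : ∀ m : Fin 2, Kf i₀ →+* Kf (tl m))
    (δ : 𝓞 (Kf i₀)) : ∀ j : Fin 2, 𝓞 (Kf (tl j)) := fun j =>
  Fin.cases (motive := fun j : Fin 2 => 𝓞 (Kf (tl j))) (RingOfIntegers.mapRingHom (i 0) δ)
    (fun l => Fin.cases (motive := fun l : Fin 1 => 𝓞 (Kf (tl l.succ)))
      (RingOfIntegers.mapRingHom ((i 1).comp (IsCMField.complexConj (Kf i₀)).toRingEquiv.toRingHom) δ)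
      (fun l' => l'.elim0) l) j

/-- First component of `pairStructure`. [folklore] -/
@[simp] theorem pairStructure_zero [∀ i, NumberField (Kf i)] [∀ i, IsCMField (Kf i)] (δ : 𝓞 (Kf i₀)) :
    pairStructure i δ 0 = RingOfIntegers.mapRingHom (i 0) δ := rfl

/-- Second component of `pairStructure`. [folklore] -/
@[simp] theorem pairStructure_one [∀ i, NumberField (Kf i)] [∀ i, IsCMField (Kf i)] (δ : 𝓞 (Kf i₀)) :
    pairStructure i δ 1 =
      RingOfIntegers.mapRingHom ((i 1).comp (IsCMField.complexConj (Kf i₀)).toRingEquiv.toRingHom) δ := rfl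

include he_sign in
/-- **Eigenvalues of `φ = ι₁(i₀ δ) ⊕ ι₂(ī₁ δ)` on the eigenlines of `B₁ × B₂`** (two fields): on the points of
`W₊ = {(0,s) : sign s} ⊔ {(1,s) : ¬ sign s}` the value is `+i√d`, on those of `W₋` it is `-i√d`.
[cite: vanGeemen1994HodgeAV, 4.9] [cite: Shimura1998, §5.2] -/
theorem apply_weilFamily_eq₂ [∀ i, NumberField (Kf i)] [∀ i, IsCMField (Kf i)] (h2 : Module.finrank ℚ (Kf i₀) = 2)
    {δ : 𝓞 (Kf i₀)} {d : ℕ} (hd : 0 < d)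
    (hτ : τ (δ : Kf i₀) = Complex.I * (Real.sqrt d : ℂ)) (x : (j : Fin 2) × (Kf (tl j) →+* ℂ)) :
    ((e x.1 x.2).2 = decide (x.1 = 0) →
      x.2 ((pairStructure i δ x.1 : 𝓞 (Kf (tl x.1))) : Kf (tl x.1)) = Complex.I * (Real.sqrt d : ℂ)) ∧
    ((e x.1 x.2).2 = !decide (x.1 = 0) →
      x.2 ((pairStructure i δ x.1 : 𝓞 (Kf (tl x.1))) : Kf (tl x.1)) = -(Complex.I * (Real.sqrt d : ℂ))) := by
  obtain ⟨j, s⟩ := x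
  have hconj : ComplexEmbedding.conjugate τ (δ : Kf i₀) = -(Complex.I * (Real.sqrt d : ℂ)) := by
    rw [ComplexEmbedding.conjugate_coe_eq, hτ, map_mul, Complex.conj_I, Complex.conj_ofReal, neg_mul]
  have hj : j = 0 ∨ j = 1 := by
    rcases Fin.eq_zero_or_eq_succ j with h | ⟨l, rfl⟩
    · exact Or.inl h
    · exact Or.inr (by rw [Subsingleton.elim l 0]; rfl)
  rcases hj with rfl | rfl
  · have hval0 : s ((pairStructure i δ 0 : 𝓞 (Kf (tl 0))) : Kf (tl 0)) = (s.comp (i 0)) (δ : Kf i₀) := by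
      rw [pairStructure_zero, RingOfIntegers.mapRingHom_apply]; rfl
    simp only [Fin.isValue, decide_true, Bool.not_true]
    refine ⟨fun hs => ?_, fun hs => ?_⟩
    · rw [hval0, (he_sign 0 s).2 hs, hτ]
    · rw [hval0, comp_eq_conjugate_of_sign_false (he_sign 0) h2 hd hτ hs, hconj]
  · have hval1 : s ((pairStructure i δ 1 : 𝓞 (Kf (tl 1))) : Kf (tl 1)) =
        (ComplexEmbedding.conjugate (s.comp (i 1))) (δ : Kf i₀) := by
      rw [pairStructure_one, RingOfIntegers.mapRingHom_apply, ← comp_comp_complexConj (i 1) s]; rfl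
    simp only [Fin.isValue, one_ne_zero, decide_false, Bool.not_false]
    refine ⟨fun hs => ?_, fun hs => ?_⟩
    · rw [hval1, comp_eq_conjugate_of_sign_false (he_sign 1) h2 hd hτ hs, ComplexEmbedding.conjugate_coe_eq, hconj,
        map_neg, map_mul, Complex.conj_I, Complex.conj_ofReal, neg_mul, neg_neg]
    · rw [hval1, (he_sign 1 s).2 hs, hconj]

end Counts

/-! ## §2 The Weil plane of `B₁ × B₂` (two fields) modulo Markman -/

section WeilPlane

variable {I : Type} {Kf : I → Type} [∀ i, Field (Kf i)] [∀ i, NumberField (Kf i)]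
  {i₀ : I} {tl : Fin 2 → I} {e : ∀ m : Fin 2, (Kf (tl m) →+* ℂ) ≃ ZMod 3 × Bool} {τ : Kf i₀ →+* ℂ}
  {i : ∀ m : Fin 2, Kf i₀ →+* Kf (tl m)}
  {A₃ : Fin 3 → AbelianVariety ℂ} {Φ₃ : ∀ j : Fin 3, CMType (Kf (slots i₀ tl j))}
  {ι₃ : ∀ j, 𝓞 (Kf (slots i₀ tl j)) →+* End (A₃ j)}
  {θ₃ : ∀ j, Kf (slots i₀ tl j) →+* Module.End ℂ (complexBetti (A₃ j).X 1)}

/-- **The Weil plane of `(⨁_{j<2} B_{j+1}, ι₁(i₀δ) ⊕ ι₂(ī₁δ))` is algebraic modulo Markman — two DIFFERENT sextic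
fields** (fibre counts `1`, `2`; gen 13's `CMThreefoldPair.weilClassesOf_prod_le_algebraicClasses_of_markman_curveFree`,
which allows `K₁ ≠ K₂`, transported from `B₁ × B₂` to the biproduct). [cite: Markman2025SurveySecant, Thm. 1.2 and §11.5 Step 2]
[cite: Deligne1982HodgeCycles, §5 (c)] -/
theorem weilClassesOf_biproduct_succ_le_algebraicClasses_of_markman [∀ i, IsCMField (Kf i)]
    (hW4 : Markman2025_weilClasses_algebraic_abelianFourfold)
    (h6 : ∀ m : Fin 2, Module.finrank ℚ (Kf (tl m)) = 6) (h2 : Module.finrank ℚ (Kf i₀) = 2)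
    {δ : 𝓞 (Kf i₀)} {d : ℕ} (hd : 0 < d) (hδ : ((δ : Kf i₀)) ^ 2 = -(d : Kf i₀))
    (hτ : τ (δ : Kf i₀) = Complex.I * (Real.sqrt d : ℂ))
    (hA : ∀ j, IsCMTypeRealisation (Φ₃ j) (A₃ j) (ι₃ j) (θ₃ j))
    (he_sign : ∀ (m : Fin 2) (s : Kf (tl m) →+* ℂ), s.comp (i m) = τ ↔ (e m s).2 = true)
    (hΦ : ∀ (m : Fin 2) (s : Kf (tl m) →+* ℂ), s ∈ (Φ₃ m.succ).1 ↔ (e m s).2 = decide ((e m s).1.val = m.val)) :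
    weilClassesOf (⨁ fun j : Fin 2 => A₃ j.succ)
      (biproduct.map fun j : Fin 2 => ι₃ j.succ (pairStructure i δ j)) 3 d ≤
      algebraicClasses (⨁ fun j : Fin 2 => A₃ j.succ).X 3 := by
  refine weilClassesOf_biproduct_le_algebraicClasses_of_prod (A := fun j : Fin 2 => A₃ j.succ)
    (fun j : Fin 2 => ι₃ j.succ (pairStructure i δ j)) ?_
  have h := CMThreefoldPair.weilClassesOf_prod_le_algebraicClasses_of_markman_curveFree hW4 (h6 0) (h6 1) h2 (i 0)
    ((i 1).comp (IsCMField.complexConj (Kf i₀)).toRingEquiv.toRingHom) (hA (0 : Fin 2).succ) (hA (1 : Fin 2).succ)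
    hd hδ hτ (card_fibre_zero₂ he_sign hΦ) (card_fibre_one₂ he_sign hΦ h2 hd hτ)
  rw [pairStructure_zero, pairStructure_one]
  exact h

end WeilPlane

end Summit.HodgeConjecture.CorCM.TwoSexticFields

end
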